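import Mathlib

/-!
# The Lagrangian Hessian at a constrained critical point is gauge-degenerate — the multiplier term is what makes
# `Beta.GaugeFixing`'s clause (c1) hold (cell pub-balaban, β sub-cell row an1, node LAGRANGIAN-DEGENERACY; [folklore]
# linear algebra over a commutative ring, ZERO cited facts)

HONEST FRAMING (verbatim, cell charter): discharging `BetaPertH` makes Bałaban's UV stability UNCONDITIONAL — a real
constructive-QFT result; it is NOT the continuum limit and NOT the Clay problem.  This file asserts NOTHING of Bałaban's
papers; it is the kernel half of the cell's DERIVED remark AN1.md §22.4 (node GAUGE-TERM-BACKGROUND, tree module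
`Beta.GaugeTermBackground` §4): the clause (c1) «Δ(B)·W(B) = 0» of the tree module `Beta.GaugeFixing` (pv25, BETA-0/FP-KERNEL)
— the UNFIXED one-loop fluctuation form is annihilated by the linearised residual gauge directions — holds for a form that
is the Hessian of the LAGRANGIAN (action + ⟨multiplier, constraint⟩) at a constrained critical point, as a consequence of the
second-order invariance of the action and of the constraints; and it is exactly the multiplier term (Bałaban's
«⟨H₁hC̃⁽²⁾(B′),J⟩» of [Balaban1987RG1] (2.11), p. 267 — the sector of the tree module `Beta.MultiplierSector`, whose §0 writes
print's current as `J = Qᵀω + …` with `ω` the multiplier; HERE `J` denotes the multiplier itself) that makes it hold: the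
Hessian of the action ALONE is not gauge-degenerate at a constrained (as opposed to free) critical point.  NOT summit progress.

CONTEXT (quotations fix terminology only; [Balaban1987RG1] = T. Bałaban, *Comm. Math. Phys.* **109** (1987) 249–301, p. 265):
«The gauge covariance of the averages implies that the δ-functions in (2.1) are invariant under the gauge transformations
V → V^v, W → W^v», the background V^{(k)} is obtained «by taking the critical orbit of the function A(U_k(V)) considered on the
subspace, and choosing the element of the orbit satisfying the axial gauge conditions G(V) = 0», and «A gauge transformation v
of V induces the gauge transformation v of V^{(k)} and the transformation B′ → R(v)B′. The expressions in (2.1) are invariant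
with respect to these transformations.»;  p. 267, on the term linear in B′: «−(1/g_k)⟨H₁B′,J⟩ = 0 because ⟨δA′,J⟩ = 0 for all
δA′ satisfying the condition Q̃Q_kδA′ = 0, and H₁B′ satisfies it» (read in finite dimensions — the action's gradient at the
background annihilates the kernel of the linearised constraints, i.e. lies in the range of their transpose: hypothesis (L)).

THE MODEL (finite-dimensional, coordinates `v : ν → R` centred at the background; everything below is DATA + HYPOTHESES, the
hypotheses being what «invariance to second order» and «constrained critical point» MEAN for 2-jets — dictionary clauses for
the row that types the concrete objects, never asserted here):
* the action's 2-jet: gradient `s₁ : ν → R`, Hessian `S₂ : Matrix ν ν R`;  the constraints' 2-jets (one per constraint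
  `i : μ`): rows `C₁ : Matrix μ ν R`, Hessians `C₂ : μ → Matrix ν ν R`;  the multiplier `J : μ → R`;
* the residual gauge vector fields, one per parameter `a : ρ`, to first order in `v`: `v ↦ w_a + N_a v` with `w_a = W·e_a`
  (`W : Matrix ν ρ R`, the directions AT the background — `Beta.GaugeFixing`'s `W(B)`) and linear parts `N : ρ → Matrix ν ν R`
  (for Bałaban: `w_λ` = the part of order zero and `N_λB′` the part of order one in `B′` of the linearisation in `λ` of the
  residual transformation `B′ → R(v)B′`, `v = exp iλ` equal to `1` on `T^{(k+1)}` — the typed `W(B)` of `Beta.GaugeFixing`);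
* (I1) `S₂ *ᵥ w_a + (N a)ᵀ *ᵥ s₁ = 0` — the part linear in `v` of `d/dε S(v + ε(w_a + N_a v))|₀ = 0`;
  (K1) `C₁ *ᵥ w_a = 0` — order zero of the invariance of each constraint (= `GaugeFixing`'s (c2));
  (K2) `C₂ i *ᵥ w_a + (N a)ᵀ *ᵥ (C₁ i) = 0` — the part linear in `v` of the invariance of constraint `i`;
  (L)  `s₁ + C₁ᵀ *ᵥ J = 0` — Lagrange: the background is critical for the action ON the constraint surface.
WHAT IS PROVED ([folklore]): `lagrangianHessian S₂ C₂ J = S₂ + Σ_i J i • C₂ i`;  **`lagrangianHessian_mulVec_gaugeDir`**: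
(I1) ∧ (K2) ∧ (L) ⇒ `(S₂ + Σ_i J_i C₂^i) *ᵥ w_a = 0` for every `a` — (c1), one-sided; `lagrangianHessian_mul_W`: the matrix form
`(S₂ + Σ J_i C₂^i) * W = 0`; `W_transpose_mul_lagrangianHessian`: the other side for symmetric jets (so (c1) two-sided, as
`GaugeFixing.logZ_slice_change` wants); `actionHessian_mulVec_gaugeDir`: under (I1) ∧ (L) alone `S₂ *ᵥ w_a = (N a)ᵀ *ᵥ (C₁ᵀ *ᵥ J)`
— the action's own Hessian is gauge-degenerate only where this multiplier-weighted term vanishes (free critical point `J = 0`,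
or `N = 0`: a purely translational gauge action), which is the precise sense in which the multiplier sector is load-bearing for
(c1); `constraint_mul_W`: (K1) restated as `C₁ * W = 0` ((c2)); §Witness: a 2-variable example over `ℤ` in which all four jets
hold, `S₂ w ≠ 0` and `(S₂ + J C₂) w = 0` with `S₂ + J C₂ ≠ 0` (the multiplier term is genuinely needed).  No `sorry`; axioms ⊆ {propext, Classical.choice,
Quot.sound}.  NOT HERE: that Bałaban's concrete 2-jets satisfy (I1)/(K1)/(K2)/(L) (the typed dictionary, OBJECTS.md §5(h),
D-pv25.4), any analysis, any bound, `BetaPertH`.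
-/

namespace Literature.MathematicalPhysics.QuantumFieldTheory.Balaban1983to89.Beta.LagrangianGaugeDegeneracy

open Matrix

variable {ν μ ρ : Type*} {R : Type*} [CommRing R]

/-- The LAGRANGIAN HESSIAN at the background: action Hessian plus the multiplier-weighted constraint Hessians,
`S₂ + Σ_i J_i C₂^i` (Bałaban's unfixed quadratic form of (2.11): 𝓗/Δ-terms plus ⟨J, C⁽²⁾⟩). [folklore] -/
def lagrangianHessian [Fintype μ] (S₂ : Matrix ν ν R) (C₂ : μ → Matrix ν ν R) (J : μ → R) : Matrix ν ν R :=
  S₂ + ∑ i, J i • C₂ i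

/-- Unfolding lemma. [folklore] -/
theorem lagrangianHessian_def [Fintype μ] (S₂ : Matrix ν ν R) (C₂ : μ → Matrix ν ν R) (J : μ → R) :
    lagrangianHessian S₂ C₂ J = S₂ + ∑ i, J i • C₂ i := rfl

/-- The `a`-th residual gauge direction at the background: the column `W·e_a`. [folklore] -/
def gaugeDir (W : Matrix ν ρ R) (a : ρ) : ν → R := fun k => W k a

/-- `gaugeDir W a` is `W *ᵥ Pi.single a 1`. [folklore] -/
theorem gaugeDir_eq_mulVec_single [Fintype ρ] [DecidableEq ρ] (W : Matrix ν ρ R) (a : ρ) : gaugeDir W a = W *ᵥ Pi.single a 1 := by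
  ext k
  simp [gaugeDir, Matrix.mulVec, dotProduct, Pi.single_apply]

/-- WITHOUT the multiplier term: under the action's first invariance jet (I1) and the Lagrange condition (L) the action
Hessian maps a gauge direction to the multiplier-weighted vector `N_aᵀ C₁ᵀ J` — NOT zero in general at a constrained critical
point. [folklore] -/
theorem actionHessian_mulVec_gaugeDir [Fintype ν] [Fintype μ] (S₂ : Matrix ν ν R) (s₁ : ν → R) (C₁ : Matrix μ ν R) (J : μ → R)
    (W : Matrix ν ρ R) (N : ρ → Matrix ν ν R) (a : ρ)
    (hI1 : S₂ *ᵥ gaugeDir W a + (N a)ᵀ *ᵥ s₁ = 0) (hL : s₁ + C₁ᵀ *ᵥ J = 0) :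
    S₂ *ᵥ gaugeDir W a = (N a)ᵀ *ᵥ (C₁ᵀ *ᵥ J) := by
  have hs : s₁ = -(C₁ᵀ *ᵥ J) := eq_neg_of_add_eq_zero_left hL
  have h1 : S₂ *ᵥ gaugeDir W a = -((N a)ᵀ *ᵥ s₁) := eq_neg_of_add_eq_zero_left hI1
  rw [h1, hs, Matrix.mulVec_neg, neg_neg]

/-- **(c1), ONE-SIDED.**  Under the invariance jets (I1) of the action and (K2) of every constraint, and the Lagrange
condition (L), the LAGRANGIAN Hessian annihilates every residual gauge direction:
`(S₂ + Σ_i J_i C₂^i) *ᵥ w_a = 0`.  Proof: `S₂w_a = −N_aᵀs₁`, `C₂^i w_a = −N_aᵀ c₁^i`, so the sum is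
`−N_aᵀ(s₁ + Σ_i J_i c₁^i) = −N_aᵀ(s₁ + C₁ᵀJ) = 0`. [folklore] -/
theorem lagrangianHessian_mulVec_gaugeDir [Fintype ν] [Fintype μ] (S₂ : Matrix ν ν R) (s₁ : ν → R) (C₁ : Matrix μ ν R)
    (C₂ : μ → Matrix ν ν R) (J : μ → R) (W : Matrix ν ρ R) (N : ρ → Matrix ν ν R) (a : ρ)
    (hI1 : S₂ *ᵥ gaugeDir W a + (N a)ᵀ *ᵥ s₁ = 0)
    (hK2 : ∀ i, C₂ i *ᵥ gaugeDir W a + (N a)ᵀ *ᵥ (fun k => C₁ i k) = 0)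
    (hL : s₁ + C₁ᵀ *ᵥ J = 0) :
    lagrangianHessian S₂ C₂ J *ᵥ gaugeDir W a = 0 := by
  have h1 : S₂ *ᵥ gaugeDir W a = -((N a)ᵀ *ᵥ s₁) := eq_neg_of_add_eq_zero_left hI1
  have h2 : ∀ i, C₂ i *ᵥ gaugeDir W a = -((N a)ᵀ *ᵥ (fun k => C₁ i k)) :=
    fun i => eq_neg_of_add_eq_zero_left (hK2 i)
  -- the constraint-transpose action on J, written as a sum of rows
  have hCt : C₁ᵀ *ᵥ J = ∑ i, J i • (fun k => C₁ i k) := by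
    ext k
    simp [Matrix.mulVec, dotProduct, Matrix.transpose_apply, Finset.sum_apply, mul_comm]
  have hs : s₁ = -∑ i, J i • (fun k => C₁ i k) := by
    rw [← hCt]; exact eq_neg_of_add_eq_zero_left hL
  rw [lagrangianHessian_def, Matrix.add_mulVec, Matrix.sum_mulVec]
  simp_rw [Matrix.smul_mulVec, h2, h1, hs, Matrix.mulVec_neg, Matrix.mulVec_sum, Matrix.mulVec_smul]
  simp

/-- **(c1), MATRIX FORM**: `(S₂ + Σ_i J_i C₂^i) * W = 0` when the jets hold for every gauge parameter. [folklore] -/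
theorem lagrangianHessian_mul_W [Fintype ν] [Fintype μ] (S₂ : Matrix ν ν R) (s₁ : ν → R) (C₁ : Matrix μ ν R)
    (C₂ : μ → Matrix ν ν R) (J : μ → R) (W : Matrix ν ρ R) (N : ρ → Matrix ν ν R)
    (hI1 : ∀ a, S₂ *ᵥ gaugeDir W a + (N a)ᵀ *ᵥ s₁ = 0)
    (hK2 : ∀ a i, C₂ i *ᵥ gaugeDir W a + (N a)ᵀ *ᵥ (fun k => C₁ i k) = 0)
    (hL : s₁ + C₁ᵀ *ᵥ J = 0) :
    lagrangianHessian S₂ C₂ J * W = 0 := by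
  ext k a
  have h := congrFun (lagrangianHessian_mulVec_gaugeDir S₂ s₁ C₁ C₂ J W N a (hI1 a) (hK2 a) hL) k
  simpa [Matrix.mul_apply, Matrix.mulVec, dotProduct, gaugeDir] using h

/-- **(c1), OTHER SIDE** for symmetric jets (Hessians are symmetric): `Wᵀ * (S₂ + Σ_i J_i C₂^i) = 0`, so the degeneracy
is two-sided as `GaugeFixing.logZ_slice_change` requires. [folklore] -/
theorem W_transpose_mul_lagrangianHessian [Fintype ν] [Fintype μ] (S₂ : Matrix ν ν R) (s₁ : ν → R) (C₁ : Matrix μ ν R)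
    (C₂ : μ → Matrix ν ν R) (J : μ → R) (W : Matrix ν ρ R) (N : ρ → Matrix ν ν R)
    (hS : S₂ᵀ = S₂) (hC : ∀ i, (C₂ i)ᵀ = C₂ i)
    (hI1 : ∀ a, S₂ *ᵥ gaugeDir W a + (N a)ᵀ *ᵥ s₁ = 0)
    (hK2 : ∀ a i, C₂ i *ᵥ gaugeDir W a + (N a)ᵀ *ᵥ (fun k => C₁ i k) = 0)
    (hL : s₁ + C₁ᵀ *ᵥ J = 0) :
    Wᵀ * lagrangianHessian S₂ C₂ J = 0 := by
  have hsym : (lagrangianHessian S₂ C₂ J)ᵀ = lagrangianHessian S₂ C₂ J := by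
    simp [lagrangianHessian_def, Matrix.transpose_add, Matrix.transpose_sum, Matrix.transpose_smul, hS, hC]
  have h := lagrangianHessian_mul_W S₂ s₁ C₁ C₂ J W N hI1 hK2 hL
  have ht := congrArg Matrix.transpose h
  rw [Matrix.transpose_mul, hsym, Matrix.transpose_zero] at ht
  exact ht

/-- **(c2)**: the zeroth-order constraint jets (K1) `C₁ *ᵥ w_a = 0` for all `a` say `C₁ * W = 0` — the linearised
averaging constraints are gauge-compatible. [folklore] -/
theorem constraint_mul_W [Fintype ν] (C₁ : Matrix μ ν R) (W : Matrix ν ρ R) (hK1 : ∀ a, C₁ *ᵥ gaugeDir W a = 0) :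
    C₁ * W = 0 := by
  ext i a
  have h := congrFun (hK1 a) i
  simpa [Matrix.mul_apply, Matrix.mulVec, dotProduct, gaugeDir] using h

/-! ## Sharpness witness (2 variables, 1 constraint, 1 gauge parameter, over `ℤ`)

The gauge vector field `ξ(v) = w + N v = (1, v₁)` (`w = e₁`, `N = [[0,0],[1,0]]`) has the exact invariant
`I(v) = v₂ − v₁²/2`.  Take the action `S = I + I²/2` (invariant; at `v = 0`: `s₁ = (0,1)`, `S₂ = diag(−1, 1)`) and the
constraint `C = I` (`C₁ = (0,1)`, `C₂ = diag(−1,0)`); `v = 0` is critical for `S` on `{C = 0}` with multiplier `J = −1`.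
All four jets (I1), (K1), (K2), (L) hold; the action Hessian does NOT kill the gauge direction (`S₂ w = (−1, 0)`), the
Lagrangian Hessian `S₂ + J C₂ = diag(0, 1) ≠ 0` does. -/

section Witness

/-- witness data: action Hessian `diag(−1,1)`. [folklore] -/
def wS₂ : Matrix (Fin 2) (Fin 2) ℤ := !![-1, 0; 0, 1]
/-- witness data: action gradient `(0,1)`. [folklore] -/
def ws₁ : Fin 2 → ℤ := ![0, 1]
/-- witness data: constraint row `(0,1)`. [folklore] -/
def wC₁ : Matrix (Fin 1) (Fin 2) ℤ := !![0, 1]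
/-- witness data: constraint Hessian `diag(−1,0)`. [folklore] -/
def wC₂ : Fin 1 → Matrix (Fin 2) (Fin 2) ℤ := fun _ => !![-1, 0; 0, 0]
/-- witness data: multiplier `J = −1`. [folklore] -/
def wJ : Fin 1 → ℤ := fun _ => -1
/-- witness data: gauge direction `w = e₁`. [folklore] -/
def wW : Matrix (Fin 2) (Fin 1) ℤ := !![1; 0]
/-- witness data: linear part of the gauge field `N = [[0,0],[1,0]]`. [folklore] -/
def wN : Fin 1 → Matrix (Fin 2) (Fin 2) ℤ := fun _ => !![0, 0; 1, 0]

/-- The witness satisfies (I1). [folklore] -/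
theorem witness_I1 (a : Fin 1) : wS₂ *ᵥ gaugeDir wW a + (wN a)ᵀ *ᵥ ws₁ = 0 := by
  fin_cases a; decide

/-- The witness satisfies (K1) (= (c2)). [folklore] -/
theorem witness_K1 (a : Fin 1) : wC₁ *ᵥ gaugeDir wW a = 0 := by
  fin_cases a; decide

/-- The witness satisfies (K2). [folklore] -/
theorem witness_K2 (a i : Fin 1) : wC₂ i *ᵥ gaugeDir wW a + (wN a)ᵀ *ᵥ (fun k => wC₁ i k) = 0 := by
  fin_cases a; fin_cases i; decide

/-- The witness satisfies the Lagrange condition (L) with `J = −1`. [folklore] -/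
theorem witness_L : ws₁ + wC₁ᵀ *ᵥ wJ = 0 := by
  decide

/-- SHARPNESS: the ACTION Hessian alone does not annihilate the gauge direction (`S₂ w = (−1,0) ≠ 0`) — at a constrained
critical point with `J ≠ 0` the multiplier term is needed. [folklore] -/
theorem witness_actionHessian_not_degenerate : wS₂ *ᵥ gaugeDir wW 0 ≠ 0 := by
  decide

/-- … while the LAGRANGIAN Hessian does (an instance of `lagrangianHessian_mulVec_gaugeDir`), and is itself non-zero
(`diag(0,1)`), so the degeneracy is not the trivial one. [folklore] -/
theorem witness_lagrangianHessian_degenerate :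
    lagrangianHessian wS₂ wC₂ wJ *ᵥ gaugeDir wW 0 = 0 ∧ lagrangianHessian wS₂ wC₂ wJ ≠ 0 := by
  exact ⟨lagrangianHessian_mulVec_gaugeDir wS₂ ws₁ wC₁ wC₂ wJ wW wN 0 (witness_I1 0) (witness_K2 0) witness_L, by decide⟩

end Witness

end Literature.MathematicalPhysics.QuantumFieldTheory.Balaban1983to89.Beta.LagrangianGaugeDegeneracy
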